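import Literature.NumberTheory.Rogawski1990.LocalEndoscopicCentralDockCM     -- ★ p841366 `exists_centralDock_of_fst_eq_smul_one` and its §1∕§2 bricks
import Literature.NumberTheory.Rogawski1990.LocalKappaDockFlip              -- ★ p842189 `finKappaAt_dock_conj_eq_neg`, `twistGram_antidiag_endoGL_zero_zero ∕ _two_two`
import HarnessLib

/-!
# The CENTRAL DOCK carries its FORM RELATION `ᵗ(σy) H′_v y = a·Φ₃` (`a ∈ L⁺_v^×`), and the κ-flip along the dock holds for `a·Φ₃`
# (Rogawski 1990 §4.3 (4.3.2), §4.9 Prop. 4.9.1, §8.1 Prop. 8.1.3, §14.2 p. 232 (i); Labesse–Langlands 1979 §2; Platonov–Rapinchuk §2.3)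

Topic `NumberTheory/Rogawski1990`; namespace `Literature.NumberTheory.Rogawski1990`.  THEOREMS ONLY (no `def`, no instance, no notation, no named fact,
no `sorry`).  Cell `pub/hodgecm-mathlib`, crux H413 (`stmt-HodgeConjecture-24833`), floor-2 line «N6nsGerm», binder `halt` of `stub_N6nsS2` (LEAD F0P3a-plan (g9)
WORD T8-134 (a), heir item of F0P3-p02 (g11) 07:21:33Z): the dock's form relation, exported BY NAME, and the sign flip (J2a)(ii) in the form the dock can feed.

THE POINT.  ★ `exists_centralDock_of_fst_eq_smul_one` builds `θ : H_v ≃ₜ* Z_{G′_v}(ε)`, `(θ z).val = y · ι_v(z) · y⁻¹`, with `y := T` taken from the rank-3 local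
classification ★ `exists_formCongr_map_eq_smul_antidiag_of_smul_eq`, which delivers `ᵗ(σT) · H′_v · T = a · Φ₃` for a σ-FIXED UNIT `a ∈ L⁺_v` — not `Φ₃` on the nose (at a
non-split `v` the two classes of rank-3 hermitian forms differ by the discriminant modulo norms, so `a` can be removed iff `a ∈ N(L_w^×)`; the unitary groups of `Φ₃` and
`a·Φ₃` coincide, which is all the dock needs).  ★ `exists_centralDock_of_fst_eq_smul_one` DROPS this conjunct; ★ `finKappaAt_dock_conj_eq_neg` ((J2a)(ii)) asks for the exact
relation `ᵗ(σy) H′_v y = Φ₃` (`hy`).  This file closes the gap without touching either ★ module: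
* §1 `twistGram_smul_form` (`H_{a·J}(M) = a · H_J(M)`), `exists_isUnit_and_twistGram_smul_eq_iff` (the NORM TEST `H_J(M)ⱼⱼ = σ(z) z · H_J(N)ⱼⱼ` is invariant under
  `J ↦ a·J` for a unit `a` — the twisted Gram matrix is linear in the form and a unit cancels);
* §2 **`exists_centralDock_form_of_fst_eq_smul_one`** = ★ `exists_centralDock_of_fst_eq_smul_one` VERBATIM plus the conjunct
  `∃ a, IsUnit a ∧ σ a = a ∧ formCongr σ y H′_v = a • Φ₃` (in ★ `finKappaAt_dock_conj_eq_neg`'s tokens: `(adelicForm L 3 H′).map (adeleToLocal L v)` and the `Matrix.of` literal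
  over `∏_{w∣v} L_w`); proof = the ★ proof keeping the conjunct it discards (+ ★ `adelicForm_map_adeleToLocal`);
* §3 **`finKappaAt_dock_conj_eq_neg_of_formCongr_eq_smul`** = ★ `finKappaAt_dock_conj_eq_neg` with `hy` weakened to `ᵗ(σy) H′_v y = a • Φ₃`, `IsUnit a`; proof = the ★ proof
  with ONE extra rewrite (§1) in each of the two `fin_cases` branches.
So the junction binder `halt` is assembled from §2 (dock + form) ∘ ★ `exists_torusTransport` ∘ ★ (J2a)(i) `exists_isLocalStablyConjH_not_isConj_forall_isConj_or` ∘ §3.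
HONEST LABEL: HC_CM is proved only modulo the printed citations (2 remaining named inputs hLiu418, h413) until rung 0 closes; this file is linear algebra over ★ modules and pays
nothing by itself.

## References
* [Rogawski1990] J. D. Rogawski, *Automorphic Representations of Unitary Groups in Three Variables*, Ann. of Math. Stud. 123 (1990), §3.1 p. 19, §4.3 (4.3.2) pp. 42–44,
  §4.9 Prop. 4.9.1 p. 55, §8.1 Prop. 8.1.3 p. 116, §8.2 Prop. 8.2.1 (c) pp. 113–115, §14.2 p. 232 (i).
* [LabesseLanglands1979] J.-P. Labesse, R. P. Langlands, *L-indistinguishability for SL(2)*, Canad. J. Math. 31 (1979), §2.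
* [PlatonovRapinchuk1994] V. Platonov, A. Rapinchuk, *Algebraic Groups and Number Theory* (1994), §2.3 (local classification of hermitian forms).
-/

set_option autoImplicit false

noncomputable section

open NumberField IsDedekindDomain Topology Matrix
open scoped MatrixGroups

namespace Literature.NumberTheory.Rogawski1990

open Literature.NumberTheory.Automorphic Literature.NumberTheory.Automorphic.UnitaryGroup
open Literature.NumberTheory.GaloisRepresentations

/-! ## §1 The twisted Gram matrix is linear in the form; the norm test is invariant under scaling the form by a unit -/

section Smul

variable {R : Type*} [CommRing R] (σ : R →+* R)

/-- `H_{a·J}(M) = ᵗ(σM) (a·J) M = a · H_J(M)`. [cite: Rogawski1990, §3.1 p. 19] -/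
theorem twistGram_smul_form {n : Type*} [Fintype n] (a : R) (J : Matrix n n R) (M : Matrix n n R) :
    twistGram σ (a • J) M = a • twistGram σ J M := by
  rw [twistGram_def, twistGram_def, Matrix.mul_smul, Matrix.smul_mul]

/-- **The norm test is invariant under `J ↦ a·J`, `a` a unit**: `(∃ z unit, H_{aJ}(M)ⱼⱼ = σ(z) z · H_{aJ}(N)ⱼⱼ) ↔ (∃ z unit, H_J(M)ⱼⱼ = σ(z) z · H_J(N)ⱼⱼ)`
(both sides of the first test are `a ·` the second's, and `a` cancels). [cite: Rogawski1990, §4.3 (4.3.2) p. 43; §3.5 p. 29] -/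
theorem exists_isUnit_and_twistGram_smul_eq_iff {n : Type*} [Fintype n] {a : R} (ha : IsUnit a) (J : Matrix n n R) (M N : Matrix n n R) (j : n) :
    (∃ z : R, IsUnit z ∧ twistGram σ (a • J) M j j = σ z * z * twistGram σ (a • J) N j j) ↔
      (∃ z : R, IsUnit z ∧ twistGram σ J M j j = σ z * z * twistGram σ J N j j) := by
  simp only [twistGram_smul_form, Matrix.smul_apply, smul_eq_mul]
  refine ⟨fun ⟨z, hz, hzz⟩ => ⟨z, hz, ha.mul_left_cancel ?_⟩, fun ⟨z, hz, hzz⟩ => ⟨z, hz, ?_⟩⟩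
  · rw [hzz]; ring
  · rw [hzz]; ring

end Smul

/-! ## §2 The central dock WITH its form relation -/

section CM

variable (L : Type) [Field L] [NumberField L] [IsCMField L] {H' : Matrix (Fin 3) (Fin 3) L}
  (v : HeightOneSpectrum (𝓞 ↥(maximalRealSubfield L)))

/-- **THE CENTRAL DOCK, WITH ITS FORM RELATION.**  At a NON-SPLIT finite place `v` (`w ∣ v`, `w̄ = w`), for `H′` hermitian with `det H′ ≠ 0` and
`ε_H = (a·1₂, u) ∈ H_v` with `u ≠ a`: there are `ε ∈ G′_v = U(H′)(L⁺_v)` MATCHED with `ε_H`, a conjugator `y ∈ GL₃(∏_{w∣v} L_w)`, an isomorphism of topological groups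
`θ : H_v ≃ₜ* Z_{G′_v}(ε)` with `θ ε_H = ε` and `(θ z).val = y · ι_v(z) · y⁻¹`, **and a σ-fixed unit `a₀ ∈ ∏_{w∣v} L_w` with `ᵗ(σy) · H′_v · y = a₀ · Φ₃`** — the form
relation of the local congruence `U(Φ₃)(L⁺_v) ≅ U(H′)(L⁺_v)` (★ rank-3 local classification), which ★ `exists_centralDock_of_fst_eq_smul_one` uses and discards.  Stated in the
tokens of ★ `finKappaAt_dock_conj_eq_neg`'s binder `hy` (`(adelicForm L 3 H′).map (adeleToLocal L v)`, `Matrix.of` literal), with the honest scalar `a₀`.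
[cite: Rogawski1990, §4.3 pp. 42–44; §8.1 Prop. 8.1.3 p. 116; §14.2 p. 232 (i)] [cite: PlatonovRapinchuk1994, §2.3] -/
theorem exists_centralDock_form_of_fst_eq_smul_one (w : PlacesOver L v) (hw : IsCMField.complexConj L • w.1 = w.1)
    (hH' : (H'.map (cmConjRingHom L))ᵀ = H') (hdet' : H'.det ≠ 0)
    (εH : (cmDatum L 2 (Matrix.of fun i j : Fin 2 => if i.val + j.val + 1 = 2 then (1 : L) else 0)).Local v ×
      (cmDatum L 1 (Matrix.of fun i j : Fin 1 => if i.val + j.val + 1 = 1 then (1 : L) else 0)).Local v)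
    (a : LocalRing L v) (ha : εH.1.val.val = a • 1) (hu : εH.2.val.val 0 0 ≠ a) :
    ∃ (ε : (cmDatum L 3 H').Local v) (y : GL (Fin 3) (LocalRing L v))
      (θ : ((cmDatum L 2 (Matrix.of fun i j : Fin 2 => if i.val + j.val + 1 = 2 then (1 : L) else 0)).Local v ×
          (cmDatum L 1 (Matrix.of fun i j : Fin 1 => if i.val + j.val + 1 = 1 then (1 : L) else 0)).Local v) ≃ₜ*
        ↥(Subgroup.centralizer ({ε} : Set ((cmDatum L 3 H').Local v)))),
      IsLocalNormPair L H' v εH ε ∧ (θ εH).1 = ε ∧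
        (∀ z, (((θ z).1).val : GL (Fin 3) (LocalRing L v)) = y * ((endoEmbLocal L v z).val : GL (Fin 3) (LocalRing L v)) * y⁻¹) ∧
        ∃ a₀ : LocalRing L v, IsUnit a₀ ∧ conjLocal L (IsCMField.complexConj L) v a₀ = a₀ ∧
          formCongr (conjLocal L (IsCMField.complexConj L) v) y ((adelicForm L 3 H').map (adeleToLocal L v)) =
            a₀ • (Matrix.of fun i j : Fin 3 => if i.val + j.val + 1 = 3 then (1 : LocalRing L v) else 0) := by
  haveI : Algebra.IsQuadraticExtension ↥(maximalRealSubfield L) L := IsCMField.isQuadraticExtension L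
  -- (1) the local congruence `U(Φ₃)(L⁺_v) ≅ U(H′)(L⁺_v)` from the rank-3 classification at the non-split place — KEEPING `σ a₀ = a₀`
  obtain ⟨T, a₀, ha₀, hσa₀, hT⟩ := exists_formCongr_map_eq_smul_antidiag_of_smul_eq L (IsCMField.complexConj L) (IsCMField.complexConj_ne_one L) H'
    ((map_cmConjRingHom_eq_map_complexConj L H') ▸ hH') hdet' w hw
  let cT : (cmDatum L 3 (Matrix.of fun i j : Fin 3 => if i.val + j.val + 1 = 3 then (1 : L) else 0)).Local v ≃ₜ* (cmDatum L 3 H').Local v :=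
    cmDatumLocalCongr L v T ha₀ hT
  -- (2) the composite embedding `f = c_T ∘ ι_v : H_v →* G′_v`
  let f : ((cmDatum L 2 (Matrix.of fun i j : Fin 2 => if i.val + j.val + 1 = 2 then (1 : L) else 0)).Local v ×
      (cmDatum L 1 (Matrix.of fun i j : Fin 1 => if i.val + j.val + 1 = 1 then (1 : L) else 0)).Local v) →* (cmDatum L 3 H').Local v :=
    cT.toMonoidHom.comp (endoEmbLocal L v)
  have hf : ∀ z, f z = cT (endoEmbLocal L v z) := fun _ => rfl
  have hfval : ∀ z, ((f z).val : GL (Fin 3) (LocalRing L v)) = T * ((endoEmbLocal L v z).val : GL (Fin 3) (LocalRing L v)) * T⁻¹ :=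
    fun z => coe_cmDatumLocalCongr_apply L v T ha₀ hT _
  have hind : IsInducing f := cT.toHomeomorph.isInducing.comp (isClosedEmbedding_endoEmbLocal L v).isInducing
  have hinj : Function.Injective f := cT.injective.comp (endoEmbLocal_injective L v)
  -- (3) `Z_{G′_v}(f ε_H) ⊆ range f`
  have hsurj : ∀ g ∈ Subgroup.centralizer ({f εH} : Set ((cmDatum L 3 H').Local v)), g ∈ Set.range f := by
    intro g hg
    have hg' : cT.symm g ∈ Subgroup.centralizer ({endoEmbLocal L v εH} : Set _) := by
      rw [Subgroup.mem_centralizer_singleton_iff] at hg ⊢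
      apply cT.injective
      rw [map_mul, map_mul, ContinuousMulEquiv.apply_symm_apply, ← hf, hg]
    obtain ⟨z, hz⟩ := mem_range_endoEmbLocal_of_mem_centralizer_of_fst_eq_smul_one L v w hw εH a ha hu hg'
    exact ⟨z, by rw [hf, hz, ContinuousMulEquiv.apply_symm_apply]⟩
  -- (4) `Z_{H_v}(ε_H) ≃ₜ* Z_{G′_v}(f ε_H)`, and `Z_{H_v}(ε_H) = H_v`
  obtain ⟨e, he⟩ := exists_continuousMulEquiv_centralizer_of_isInducing f hind hinj εH hsurj
  have hcent : ∀ z, z ∈ Subgroup.centralizer ({εH} : Set _) :=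
    fun z => Subgroup.mem_centralizer_singleton_iff.mpr (mul_comm_of_fst_eq_smul_one L v εH a ha z)
  let e₀ : ((cmDatum L 2 (Matrix.of fun i j : Fin 2 => if i.val + j.val + 1 = 2 then (1 : L) else 0)).Local v ×
      (cmDatum L 1 (Matrix.of fun i j : Fin 1 => if i.val + j.val + 1 = 1 then (1 : L) else 0)).Local v) ≃ₜ*
      ↥(Subgroup.centralizer ({εH} : Set _)) :=
    { toFun := fun z => ⟨z, hcent z⟩
      invFun := fun z => z.1
      left_inv := fun _ => rfl
      right_inv := fun _ => rfl
      map_mul' := fun _ _ => rfl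
      continuous_toFun := continuous_id.subtype_mk _
      continuous_invFun := continuous_subtype_val }
  refine ⟨f εH, T, e₀.trans e, ?_, ?_, fun z => ?_, a₀, ha₀, hσa₀, ?_⟩
  · -- matching: `ι_v(ε_H)` and `ε = T ι_v(ε_H) T⁻¹` are conjugate in `GL₃`
    rw [isLocalNormPair_iff]
    exact isConj_iff.mpr ⟨T, hfval εH⟩
  · rw [ContinuousMulEquiv.trans_apply, he]; rfl
  · rw [ContinuousMulEquiv.trans_apply, he]
    exact hfval z
  · -- (5) the form relation, in the `adelicForm ∘ adeleToLocal` ∕ `Matrix.of` tokens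
    rw [adelicForm_map_adeleToLocal, hT]
    congr 1
    ext i j
    simp only [Matrix.map_apply, Matrix.of_apply]
    split_ifs <;> simp

end CM

/-! ## §3 The κ-flip along a dock whose form relation is `ᵗ(σy) H′_v y = a₀·Φ₃` -/

section Flip

variable (L : Type) [Field L] [NumberField L] [IsCMField L] (v : HeightOneSpectrum (𝓞 ↥(maximalRealSubfield L)))
  (H' : Matrix (Fin 3) (Fin 3) L)

/-- **(J2a)(ii) THE κ-FLIP ALONG A DOCK `z ↦ y ι(z) y⁻¹` WITH FORM RELATION `ᵗ(σy) H′_v y = a₀·Φ₃`, `a₀` A UNIT** — ★ `finKappaAt_dock_conj_eq_neg` with its binder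
`hy : ᵗ(σy) H′_v y = Φ₃` weakened to the relation the central dock actually supplies (§2 `exists_centralDock_form_of_fst_eq_smul_one`).  At a non-split `v`, `γ_H ∈ H_v`
(`u := finGammaTwo γ_H`, `G`-regular), `b ∈ G′_v` matched with `γ_H` with eigenframe `y ι(P, 1)`, eigenvalues `(d₀, u₁, d₁)`, `u = dⱼ` in the PLANE; if `x ∈ GL₂` FAILS the
`Φ₂`-norm test at `P`'s column `j`, then for `b′ = g b g⁻¹`, `g = y ι(x,1) y⁻¹`: `κ_v(γ_H, b′) = −κ_v(γ_H, b)`.  Proof = the ★ proof: ★ `finKappaAt_conj_eq_mul_ite` at the slot of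
`u`, ★ `twistGram_formCongr`, `hy`, then §1 `exists_isUnit_and_twistGram_smul_eq_iff` removes `a₀` from the test, and the `ι`-pattern Gram entries ★ `twistGram_antidiag_endoGL_…`.
[cite: Rogawski1990, §4.3 (4.3.2) p. 43; §4.9 Prop. 4.9.1 p. 55; §8.2 Prop. 8.2.1 (c) pp. 113–115] [cite: LabesseLanglands1979, §2] -/
theorem finKappaAt_dock_conj_eq_neg_of_formCongr_eq_smul (w : PlacesOver L v) (hw : IsCMField.complexConj L • w.1 = w.1)
    {a : (cmDatum L 2 (Matrix.of fun i j : Fin 2 => if i.val + j.val + 1 = 2 then (1 : L) else 0)).Local v ×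
      (cmDatum L 1 (Matrix.of fun i j : Fin 1 => if i.val + j.val + 1 = 1 then (1 : L) else 0)).Local v}
    {b b' : (cmDatum L 3 H').Local v} (h : IsLocalNormPair L H' v a b)
    (hu : IsUnit ((finCharpolyTwo L v a).eval (finGammaTwo L v a)))
    (hH : (((adelicForm L 3 H').map (adeleToLocal L v)).map (conjLocal L (IsCMField.complexConj L) v))ᵀ = (adelicForm L 3 H').map (adeleToLocal L v))
    (hHd : IsUnit ((adelicForm L 3 H').map (adeleToLocal L v)).det)
    {y : GL (Fin 3) (LocalRing L v)} {a₀ : LocalRing L v} (ha₀ : IsUnit a₀)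
    (hy : formCongr (conjLocal L (IsCMField.complexConj L) v) y ((adelicForm L 3 H').map (adeleToLocal L v)) =
      a₀ • (Matrix.of fun i j : Fin 3 => if i.val + j.val + 1 = 3 then (1 : LocalRing L v) else 0))
    {P x : GL (Fin 2) (LocalRing L v)} {d₀ d₁ u₁ : LocalRing L v}
    (hP : (b.val.val : Matrix (Fin 3) (Fin 3) (LocalRing L v)) * (y * endoGL (P, (1 : GL (Fin 1) (LocalRing L v)))).val =
      (y * endoGL (P, (1 : GL (Fin 1) (LocalRing L v)))).val * diagonal ![d₀, u₁, d₁])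
    (hinj : Function.Injective ![d₀, u₁, d₁]) (h1 : ∀ i, conjLocal L (IsCMField.complexConj L) v (![d₀, u₁, d₁] i) * ![d₀, u₁, d₁] i = 1)
    {j : Fin 2} (hj : ![d₀, d₁] j = finGammaTwo L v a)
    (hfail : ¬ ∃ z : LocalRing L v, IsUnit z ∧
      twistGram (conjLocal L (IsCMField.complexConj L) v) (Matrix.of fun i j : Fin 2 => if i.val + j.val + 1 = 2 then (1 : LocalRing L v) else 0)
          (x.val * P.val) j j =
        conjLocal L (IsCMField.complexConj L) v z * z *
          twistGram (conjLocal L (IsCMField.complexConj L) v) (Matrix.of fun i j : Fin 2 => if i.val + j.val + 1 = 2 then (1 : LocalRing L v) else 0) P.val j j)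
    (hg : (y * endoGL (x, (1 : GL (Fin 1) (LocalRing L v))) * y⁻¹) * b.val * (y * endoGL (x, (1 : GL (Fin 1) (LocalRing L v))) * y⁻¹)⁻¹ = b'.val) :
    finKappaAt L v H' a b' = - finKappaAt L v H' a b := by
  -- the frame product `g · (y ι(P,1)) = y ι(xP, 1)`
  have hgP : (y * endoGL (x, (1 : GL (Fin 1) (LocalRing L v))) * y⁻¹).val * (y * endoGL (P, (1 : GL (Fin 1) (LocalRing L v)))).val =
      y.val * (endoGL (x * P, (1 : GL (Fin 1) (LocalRing L v)))).val := by
    rw [← Units.val_mul, show (y * endoGL (x, (1 : GL (Fin 1) (LocalRing L v))) * y⁻¹) * (y * endoGL (P, (1 : GL (Fin 1) (LocalRing L v)))) =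
        y * endoGL (x * P, (1 : GL (Fin 1) (LocalRing L v))) by
      rw [show ((x * P, (1 : GL (Fin 1) (LocalRing L v))) : GL (Fin 2) (LocalRing L v) × GL (Fin 1) (LocalRing L v)) = (x, 1) * (P, 1) by
        rw [Prod.mk_mul_mk, mul_one], map_mul]; group]
    rfl
  have hyP : (y * endoGL (P, (1 : GL (Fin 1) (LocalRing L v)))).val = y.val * (endoGL (P, (1 : GL (Fin 1) (LocalRing L v)))).val := rfl
  -- the slot of `u = finGammaTwo a` in the frame `(d₀, u₁, d₁)`
  fin_cases j
  · have hj0 : ![d₀, u₁, d₁] 0 = finGammaTwo L v a := by simpa using hj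
    rw [finKappaAt_conj_eq_mul_ite L v H' a b b' w hw h hu hH hHd hP hinj h1 hj0 hg, if_neg, mul_neg_one]
    rw [hgP, hyP, twistGram_formCongr, twistGram_formCongr, hy,
      exists_isUnit_and_twistGram_smul_eq_iff _ ha₀, twistGram_antidiag_endoGL_zero_zero, twistGram_antidiag_endoGL_zero_zero]
    simpa using hfail
  · have hj2 : ![d₀, u₁, d₁] 2 = finGammaTwo L v a := by simpa using hj
    rw [finKappaAt_conj_eq_mul_ite L v H' a b b' w hw h hu hH hHd hP hinj h1 hj2 hg, if_neg, mul_neg_one]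
    rw [hgP, hyP, twistGram_formCongr, twistGram_formCongr, hy,
      exists_isUnit_and_twistGram_smul_eq_iff _ ha₀, twistGram_antidiag_endoGL_two_two, twistGram_antidiag_endoGL_two_two]
    simpa using hfail

end Flip

end Literature.NumberTheory.Rogawski1990

end
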